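import Literature.AlgebraicGeometry.Motives.MixedHodgeStructureSocleHodgeClasses
import HarnessLib

/-!
# Hodge classes of a `ℚ`-split mixed Hodge structure are the Hodge classes of `Gr^W_{2p}`

Arapura, *Hodge cycles and the Leray filtration*, §1 Lemma 1.1 (1): `Hodge(H) ↪ Hodge(Gr^W_0 H)`, an isomorphism
when `H` has non-negative weights (the tree's `hodgeClassesToGr_injective`, `hodgeClassesEquivGr`). Here: the
comparison map is **surjective for every `ℚ`-split MHS** (CEGL Ch. 12 footnote 2, p. 527: "precisely the `ℚ`-split
mixed Hodge structures"; Green–Griffiths–Kerr (I.C.7)–(I.C.8): `H ≅ ⊕ Gr^W_n H` over `ℚ`), in particular for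
semisimple and for graded-polarizable semisimple MHS, because the weight piece `U_{2p} ⊆ H` maps isomorphically onto
`Gr^W_{2p} H` (the tree's `IsSplitOverQ.weightPieceGrHom_bijective`). Since the Hodge classes of ANY MHS are those of
its (semisimple, hence `ℚ`-split) socle (`hodgeClasses_eq_map_hodgeClasses_socle`), **`Hdgᵖ(H) ≅ Hdgᵖ(Gr^W_{2p} soc H)`
for every MHS `H`**. Namespace `MixedHodgeStructure`; everything proved, no named facts.

## References

* [Arapura2022] D. Arapura, Hodge cycles and the Leray filtration, Pacific J. Math. 319 (2022), §1 Lemma 1.1 (1).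
* [CattaniElZeinGriffithsLe2014] E. Cattani et al. (eds.), Hodge Theory (2014), Def. 3.2.15, Ch. 12 fn. 2 (p. 527).
* [GreenGriffithsKerr2012] M. Green, P. Griffiths, M. Kerr, Mumford–Tate groups and domains (2012), §I.C (I.C.7)–(I.C.8).
-/

noncomputable section

namespace Literature.AlgebraicGeometry.Motives

namespace MixedHodgeStructure

universe u

variable {V : Type u} [AddCommGroup V] [Module ℚ V]
variable {H : MixedHodgeStructure V}

open Module

/-! ### §1 The comparison map in general: `dim Hdgᵖ(H) ≤ dim Hdgᵖ(Gr^W_{2p} H)` -/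

/-- The comparison map co-restricted to the Hodge classes of `Gr^W_{2p} H` is injective. [cite: Arapura2022, §1 Lemma 1.1 (1)] -/
theorem hodgeClassesToGr_codRestrict_injective (H : MixedHodgeStructure V) (p : ℤ) :
    Function.Injective ((H.hodgeClassesToGr p).codRestrict _ (hodgeClassesToGr_mem H p)) := fun _ _ hab =>
  hodgeClassesToGr_injective H p (congrArg Subtype.val hab)

/-- **`dim Hdgᵖ(H) ≤ dim Hdgᵖ(Gr^W_{2p} H)`** for every MHS. [cite: Arapura2022, §1 Lemma 1.1 (1)] -/
theorem finrank_hodgeClasses_le_gr [FiniteDimensional ℚ V] (H : MixedHodgeStructure V) (p : ℤ) :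
    finrank ℚ (H.hodgeClasses p) ≤ finrank ℚ ((H.gr (2 * p)).hodgeClasses p) :=
  LinearMap.finrank_le_finrank_of_injective (hodgeClassesToGr_codRestrict_injective H p)

/-! ### §2 `ℚ`-split MHS: the comparison map is bijective -/

/-- **For a `ℚ`-split MHS every Hodge class of `Gr^W_{2p} H` is the class of a Hodge class of `H`** (lift it to the
weight piece `U_{2p} ⥲ Gr^W_{2p} H`). [cite: GreenGriffithsKerr2012, §I.C (I.C.7)–(I.C.8)] [cite: Arapura2022, §1 Lemma 1.1 (1)] -/
theorem IsSplitOverQ.exists_mem_hodgeClasses_toGr_eq (hs : H.IsSplitOverQ) {p : ℤ} {y : grW H.W (2 * p)}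
    (hy : y ∈ (H.gr (2 * p)).hodgeClasses p) : ∃ v : H.hodgeClasses p, H.hodgeClassesToGr p v = y := by
  have hy' : y ∈ (H.gr (2 * p)).toMixedHodgeStructure.hodgeClasses p := by
    rw [HodgeStructure.toMixedHodgeStructure_hodgeClasses _ le_rfl]; exact hy
  obtain ⟨u, hu, huy⟩ := (hs.weightPieceGrHom (2 * p)).exists_mem_hodgeClasses_apply_eq_of_bijective
    (hs.weightPieceGrHom_bijective (2 * p)) hy'
  have huV : (u : V) ∈ H.hodgeClasses p := (SubMixedHodgeStructure.mem_hodgeClasses_iff _ p u).1 hu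
  exact ⟨⟨u, huV⟩, by rw [← huy, hodgeClassesToGr_apply, IsSplitOverQ.weightPieceGrHom_toLinearMap_apply]⟩

/-- **`ℚ`-split: `Hdgᵖ(H) → Hdgᵖ(Gr^W_{2p} H)` is bijective.** [cite: GreenGriffithsKerr2012, §I.C (I.C.7)–(I.C.8)]
[cite: Arapura2022, §1 Lemma 1.1 (1)] -/
theorem IsSplitOverQ.hodgeClassesToGr_codRestrict_bijective (hs : H.IsSplitOverQ) (p : ℤ) :
    Function.Bijective ((H.hodgeClassesToGr p).codRestrict _ (hodgeClassesToGr_mem H p)) := by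
  refine ⟨hodgeClassesToGr_codRestrict_injective H p, fun ⟨y, hy⟩ => ?_⟩
  obtain ⟨v, hv⟩ := hs.exists_mem_hodgeClasses_toGr_eq hy
  exact ⟨v, Subtype.ext hv⟩

/-- **`ℚ`-split: `Hdgᵖ(H) ≃ Hdgᵖ(Gr^W_{2p} H)`, `v ↦ [v]`.** [cite: GreenGriffithsKerr2012, §I.C (I.C.7)–(I.C.8)]
[cite: Arapura2022, §1 Lemma 1.1 (1)] -/
def IsSplitOverQ.hodgeClassesEquivGr (hs : H.IsSplitOverQ) (p : ℤ) :
    H.hodgeClasses p ≃ₗ[ℚ] (H.gr (2 * p)).hodgeClasses p :=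
  LinearEquiv.ofBijective _ (hs.hodgeClassesToGr_codRestrict_bijective p)

/-- The equivalence on `v` is the class of `v`. [cite: Arapura2022, §1 Lemma 1.1 (1)] -/
@[simp]
theorem IsSplitOverQ.coe_hodgeClassesEquivGr_apply (hs : H.IsSplitOverQ) (p : ℤ) (v : H.hodgeClasses p) :
    ((hs.hodgeClassesEquivGr p v : (H.gr (2 * p)).hodgeClasses p) : grW H.W (2 * p)) = H.hodgeClassesToGr p v :=
  rfl

/-- **`ℚ`-split: `dim Hdgᵖ(H) = dim Hdgᵖ(Gr^W_{2p} H)`.** [cite: GreenGriffithsKerr2012, §I.C (I.C.7)–(I.C.8)] -/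
theorem IsSplitOverQ.finrank_hodgeClasses_eq_gr (hs : H.IsSplitOverQ) (p : ℤ) :
    finrank ℚ (H.hodgeClasses p) = finrank ℚ ((H.gr (2 * p)).hodgeClasses p) :=
  (hs.hodgeClassesEquivGr p).finrank_eq

/-- Semisimple MHS: `Hdgᵖ(H) ≃ Hdgᵖ(Gr^W_{2p} H)`. [cite: CattaniElZeinGriffithsLe2014, Ch. 12 footnote 2 (p. 527)] -/
def IsSemisimple.hodgeClassesEquivGr [FiniteDimensional ℚ V] (h : H.IsSemisimple) (p : ℤ) :
    H.hodgeClasses p ≃ₗ[ℚ] (H.gr (2 * p)).hodgeClasses p :=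
  h.isSplitOverQ.hodgeClassesEquivGr p

/-- Semisimple MHS: `dim Hdgᵖ(H) = dim Hdgᵖ(Gr^W_{2p} H)`. [cite: CattaniElZeinGriffithsLe2014, Ch. 12 footnote 2 (p. 527)] -/
theorem IsSemisimple.finrank_hodgeClasses_eq_gr [FiniteDimensional ℚ V] (h : H.IsSemisimple) (p : ℤ) :
    finrank ℚ (H.hodgeClasses p) = finrank ℚ ((H.gr (2 * p)).hodgeClasses p) :=
  h.isSplitOverQ.finrank_hodgeClasses_eq_gr p

/-- Graded-polarizable `H`: the comparison map is bijective as soon as `H` is `ℚ`-split, e.g. admits a weight grading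
by a morphism. [cite: GreenGriffithsKerr2012, §I.C (I.C.7)–(I.C.8)] -/
theorem IsGradedPolarizable.finrank_hodgeClasses_eq_gr_of_isSemisimple [FiniteDimensional ℚ V] (_hp : H.IsGradedPolarizable)
    (h : H.IsSemisimple) (p : ℤ) :
    finrank ℚ (H.hodgeClasses p) = finrank ℚ ((H.gr (2 * p)).hodgeClasses p) :=
  h.finrank_hodgeClasses_eq_gr p

/-! ### §3 Any MHS: `Hdgᵖ(H) ≅ Hdgᵖ(Gr^W_{2p} soc H)` -/

variable (H) [FiniteDimensional ℚ V]

/-- **`Hdgᵖ(H) ≃ Hdgᵖ(soc H)`** (the Hodge classes of `H` lie in the socle). [cite: Arapura2022, §1 (p. 3)]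
[cite: CattaniElZeinGriffithsLe2014, p. 270] -/
def hodgeClassesEquivSocle (p : ℤ) : H.hodgeClasses p ≃ₗ[ℚ] (socle H).toMixedHodgeStructure.hodgeClasses p :=
  (LinearEquiv.ofEq _ _ (hodgeClasses_eq_map_hodgeClasses_socle H p)).trans
    (Submodule.equivMapOfInjective _ (Submodule.injective_subtype (socle H).toSubmodule)
      ((socle H).toMixedHodgeStructure.hodgeClasses p)).symm

/-- Underlying vectors are unchanged: `(e v : V) = v`. [cite: Arapura2022, §1 (p. 3)] -/
theorem coe_hodgeClassesEquivSocle_symm_apply (p : ℤ) (u : (socle H).toMixedHodgeStructure.hodgeClasses p) :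
    (((hodgeClassesEquivSocle H p).symm u : H.hodgeClasses p) : V) = ((u : (socle H).toSubmodule) : V) := rfl

/-- **`Hdgᵖ(H) ≃ Hdgᵖ(Gr^W_{2p}(soc H))` for every MHS `H`** (the socle is semisimple, hence `ℚ`-split).
[cite: Arapura2022, §1 Lemma 1.1 (1)] [cite: CattaniElZeinGriffithsLe2014, p. 270 and Ch. 12 footnote 2 (p. 527)] -/
def hodgeClassesEquivGrSocle (p : ℤ) :
    H.hodgeClasses p ≃ₗ[ℚ] ((socle H).toMixedHodgeStructure.gr (2 * p)).hodgeClasses p :=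
  (hodgeClassesEquivSocle H p).trans ((isSplitOverQ_socle (H := H)).hodgeClassesEquivGr p)

/-- `dim Hdgᵖ(H) = dim Hdgᵖ(Gr^W_{2p}(soc H))`. [cite: Arapura2022, §1 Lemma 1.1 (1)] [cite: CattaniElZeinGriffithsLe2014, p. 270] -/
theorem finrank_hodgeClasses_eq_gr_socle (p : ℤ) :
    finrank ℚ (H.hodgeClasses p) = finrank ℚ (((socle H).toMixedHodgeStructure.gr (2 * p)).hodgeClasses p) :=
  (hodgeClassesEquivGrSocle H p).finrank_eq

end MixedHodgeStructure

end Literature.AlgebraicGeometry.Motives
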